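import Mathlib
import HarnessLib
import Summits.CriticalPhenomena.PercolationContinuityZ3.Theses.PercDustRigidity

/-!
# Birth skeleton of piece X₁ `NoInfinitelyFragileGiant` (BC2 redirect of `DustRigidity`, item
`stmt-CriticalPhenomena-9591`, route `PercDustRigidity`; crux-strategist 2026-08-17)

X₁: a probability measure on bond configurations of `ℤ³` with (H1)–(H9) (lattice support, shift
invariance, ergodicity, insertion tolerance, deletion tolerance, ergodicity under every non-zero
shift, automorphism invariance, positive association, finite coordinate half-space clusters), a.s.
at most one infinite cluster, and `Death_μ(D_k)` for every `k ≥ 1` (`D_k` = level-`k` plug sieve: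
vertical edges `s(y, y+e₃)`, `2^k ∣ y_i`), does not percolate.

Line (structure ⟹ scale-`2^k` mass transport ⟹ core):
* `stub_robustUniqueness` (provable now, M): deletion tolerance (H5) transports the null event
  {≥ 2 infinite clusters} (Burton–Keane, hypothesis U) through `ω ↦ ω \ E(Λ_N)`: a.s. closing any
  box leaves at most one infinite cluster — the giant is ONE-ENDED (robust uniqueness).
* `stub_pieceMassTransport` (provable now, M/L): under `Death_μ(D_k)` every `x ↔ ∞` lies in a FINITE
  piece `K_k(x) = C_{ω∖D_k}(x)` whose exits from the giant are open level-`k` sieve edges; sending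
  mass `1/|K_k(x)|` from `x` to each exit edge (each sieve edge receives ≤ 2) and the mass-transport
  principle for the `2^kℤ³`-stationary pair (μ, D_k) give, for every `m`,
  `Σ_{x ∈ [0,2^k)³} μ(x ↔ ∞ ∧ |K_k(x)| ≤ m) ≤ 2m`: at level `k` all but a fraction `2m/(θ̄ 8^k)` of
  the giant sits in pieces of more than `m` vertices.
* `stub_core` (open, the heart): (H1)–(H9) + U + one-endedness + the piece bounds at every level +
  `Death_μ(D_k) ∀ k` ⟹ `μ(0 ↔ ∞) = 0` — a one-ended positive-density associated finite-energy giant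
  cannot be cut into finite pieces by EVERY level of the sieve hierarchy (the bet; tools: finite-energy
  rerouting with room `2^{k-1}` around each isolated defect, positive association to glue reroutes,
  (H9) unused so far — see the card).
-/

namespace Summit.CriticalPhenomena.PercolationContinuityZ3.Cruxes.NoInfinitelyFragileGiant.Birth

open scoped BigOperators Topology Classical MeasureTheory ProbabilityTheory
open Filter Set Function TopologicalSpace MeasureTheory


/-- Robust uniqueness / one-endedness of the giant from deletion tolerance + Burton–Keane. -/
theorem stub_robustUniqueness :
    ∀ μ : MeasureTheory.Measure (Literature.Probability.Percolation.BondConfig (Literature.Probability.LatticeModels.Site 3)), MeasureTheory.IsProbabilityMeasure μ → (∀ᵐ ω ∂μ, ω ⊆ (Literature.Probability.LatticeModels.zdGraph 3).edgeSet) → (∀ (v : Literature.Probability.LatticeModels.Site 3) (S : Set (Literature.Probability.Percolation.BondConfig (Literature.Probability.LatticeModels.Site 3))), MeasurableSet S → μ (Literature.Probability.Percolation.BondConfig.relabel (Literature.Probability.Percolation.sym2Equiv (Literature.Probability.LatticeModels.Site.shift v)) ⁻¹' S) = μ S) → (∀ S : Set (Literature.Probability.Percolation.BondConfig (Literature.Probability.LatticeModels.Site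 3)), MeasurableSet S → (∀ v : Literature.Probability.LatticeModels.Site 3, Literature.Probability.Percolation.BondConfig.relabel (Literature.Probability.Percolation.sym2Equiv (Literature.Probability.LatticeModels.Site.shift v)) ⁻¹' S = S) → μ S = 0 ∨ μ S = 1) → (∀ N : ℕ, ∃ c : ℝ, 0 < c ∧ ∀ S : Set (Literature.Probability.Percolation.BondConfig (Literature.Probability.LatticeModels.Site 3)), MeasurableSet S → c * μ.real ((fun ω : Literature.Probability.Percolation.BondConfig (Literature.Probability.LatticeModels.Site 3) => ω ∪ ↑(Literature.Probability.LatticeModels.edgesIn (Literature.Probability.LatticeModels.zdGraph 3) (Literature.Probability.LatticeModels.box 3 N))) ⁻¹' S) ≤ μ.real S) → (∀ N : ℕ, ∃ c : ℝ, 0 < c ∧ ∀ S : Set (Literature.Probability.Percolation.BondConfig (Literature.Probability.LatticeModels.Site 3)), MeasurableSet S → c * μ.real ((fun ω : Literature.Probability.Percolation.BondConfig (Literature.Probability.LatticeModels.Site 3) => ω \ ↑(Literature.Probability.LatticeModels.edgesIn (Literature.Probability.LatticeModels.zdGraph 3) (Literature.Probability.LatticeModels.box 3 N))) ⁻¹'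 S) ≤ μ.real S) → (∀ᵐ ω ∂μ, Literature.Probability.Percolation.numInfiniteClusters ω ≤ 1) → ∀ᵐ ω ∂μ, ∀ N : ℕ, Literature.Probability.Percolation.numInfiniteClusters (ω \ ↑(Literature.Probability.LatticeModels.edgesIn (Literature.Probability.LatticeModels.zdGraph 3) (Literature.Probability.LatticeModels.box 3 N))) ≤ 1 := by
  sorry

/-- Scale-`2^k` mass transport: pieces of the giant cut by the level-`k` sieve are large. -/
theorem stub_pieceMassTransport :
    ∀ μ : MeasureTheory.Measure (Literature.Probability.Percolation.BondConfig (Literature.Probability.LatticeModels.Site 3)), MeasureTheory.IsProbabilityMeasure μ → (∀ᵐ ω ∂μ, ω ⊆ (Literature.Probability.LatticeModels.zdGraph 3).edgeSet) → (∀ (v : Literature.Probability.LatticeModels.Site 3) (S : Set (Literature.Probability.Percolation.BondConfig (Literature.Probability.LatticeModels.Site 3))), MeasurableSet S → μ (Literature.Probability.Percolation.BondConfig.relabel (Literature.Probability.Percolation.sym2Equiv (Literature.Probability.LatticeModels.Site.shift v)) ⁻¹' S) = μ S) → ∀ k : ℕ, 1 ≤ k → (∀ᵐ ω ∂μ, ∀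 x : Literature.Probability.LatticeModels.Site 3, (Literature.Probability.Percolation.openCluster (ω \ {e | ∃ y : Literature.Probability.LatticeModels.Site 3, (∀ i, (2 ^ k : ℤ) ∣ y i) ∧ e = s(y, y + Pi.single (2 : Fin 3) 1)}) x).Finite) → ∀ m : ℕ, ∑ x ∈ Fintype.piFinset (fun _ : Fin 3 => Finset.Ico (0 : ℤ) (2 ^ k)), μ.real {ω | (Literature.Probability.Percolation.openCluster ω x).Infinite ∧ (Literature.Probability.Percolation.openCluster (ω \ {e | ∃ y : Literature.Probability.LatticeModels.Site 3, (∀ i, (2 ^ k : ℤ) ∣ y i) ∧ e = s(y, y + Pi.single (2 : Fin 3) 1)}) x).ncard ≤ m} ≤ 2 * m := by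
  sorry

/-- The core: no one-ended, positive-density, associated, finite-energy giant is cut into finite
pieces by every level of the sieve hierarchy. -/
theorem stub_core :
    ∀ μ : MeasureTheory.Measure (Literature.Probability.Percolation.BondConfig (Literature.Probability.LatticeModels.Site 3)), MeasureTheory.IsProbabilityMeasure μ → (∀ᵐ ω ∂μ, ω ⊆ (Literature.Probability.LatticeModels.zdGraph 3).edgeSet) → (∀ (v : Literature.Probability.LatticeModels.Site 3) (S : Set (Literature.Probability.Percolation.BondConfig (Literature.Probability.LatticeModels.Site 3))), MeasurableSet S → μ (Literature.Probability.Percolation.BondConfig.relabel (Literature.Probability.Percolation.sym2Equiv (Literature.Probability.LatticeModels.Site.shift v)) ⁻¹' S) = μ S) → (∀ S : Set (Literature.Probability.Percolation.BondConfig (Literature.Probability.LatticeModels.Site 3)), MeasurableSet S → (∀ v : Literature.Probability.LatticeModels.Site 3, Literature.Probability.Percolation.BondConfig.relabel (Literature.Probability.Percolation.sym2Equiv (Literature.Probability.LatticeModels.Site.shift v)) ⁻¹' S = S) → μ S = 0 ∨ μ S = 1) → (∀ N : ℕ, ∃ c : ℝ, 0 < c ∧ ∀ S : Set (Literature.Probability.Percolation.BondConfig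 (Literature.Probability.LatticeModels.Site 3)), MeasurableSet S → c * μ.real ((fun ω : Literature.Probability.Percolation.BondConfig (Literature.Probability.LatticeModels.Site 3) => ω ∪ ↑(Literature.Probability.LatticeModels.edgesIn (Literature.Probability.LatticeModels.zdGraph 3) (Literature.Probability.LatticeModels.box 3 N))) ⁻¹' S) ≤ μ.real S) → (∀ N : ℕ, ∃ c : ℝ, 0 < c ∧ ∀ S : Set (Literature.Probability.Percolation.BondConfig (Literature.Probability.LatticeModels.Site 3)), MeasurableSet S → c * μ.real ((fun ω : Literature.Probability.Percolation.BondConfig (Literature.Probability.LatticeModels.Site 3) => ω \ ↑(Literature.Probability.LatticeModels.edgesIn (Literature.Probability.LatticeModels.zdGraph 3) (Literature.Probability.LatticeModels.box 3 N))) ⁻¹' S) ≤ μ.real S) → (∀ v : Literature.Probability.LatticeModels.Site 3, v ≠ 0 → Ergodic (Literature.Probability.Percolation.BondConfig.relabel (Literature.Probability.Percolation.sym2Equiv (Literature.Probability.LatticeModels.Site.shift v))) μ) → (∀ (γ : Literature.Probability.LatticeModels.zdGraph 3 ≃g Literature.Probability.LatticeModels.zdGraph 3) (A : Set (Literature.Probability.Percolation.BondConfig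 (Literature.Probability.LatticeModels.Site 3))), MeasurableSet A → μ (Literature.Probability.Percolation.BondConfig.relabel (Literature.Probability.Percolation.sym2Equiv γ.toEquiv) ⁻¹' A) = μ A) → (∀ A B : Set (Literature.Probability.Percolation.BondConfig (Literature.Probability.LatticeModels.Site 3)), IsUpperSet A → IsUpperSet B → MeasurableSet A → MeasurableSet B → μ A * μ B ≤ μ (A ∩ B)) → (∀ᵐ ω ∂μ, ∀ (i : Fin 3) (a : ℤ) (v : Literature.Probability.LatticeModels.Site 3), {y : Literature.Probability.LatticeModels.Site 3 | ω ∈ Literature.Probability.Percolation.openConnIn {x : Literature.Probability.LatticeModels.Site 3 | a ≤ x i} v y}.Finite ∧ {y : Literature.Probability.LatticeModels.Site 3 | ω ∈ Literature.Probability.Percolation.openConnIn {x : Literature.Probability.LatticeModels.Site 3 | x i ≤ a} v y}.Finite) → (∀ᵐ ω ∂μ, Literature.Probability.Percolation.numInfiniteClusters ω ≤ 1) → (∀ᵐ ω ∂μ, ∀ N : ℕ, Literature.Probability.Percolation.numInfiniteClusters (ω \ ↑(Literature.Probability.LatticeModels.edgesIn (Literature.Probability.LatticeModels.zdGraph 3)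 (Literature.Probability.LatticeModels.box 3 N))) ≤ 1) → (∀ k : ℕ, 1 ≤ k → ∀ m : ℕ, ∑ x ∈ Fintype.piFinset (fun _ : Fin 3 => Finset.Ico (0 : ℤ) (2 ^ k)), μ.real {ω | (Literature.Probability.Percolation.openCluster ω x).Infinite ∧ (Literature.Probability.Percolation.openCluster (ω \ {e | ∃ y : Literature.Probability.LatticeModels.Site 3, (∀ i, (2 ^ k : ℤ) ∣ y i) ∧ e = s(y, y + Pi.single (2 : Fin 3) 1)}) x).ncard ≤ m} ≤ 2 * m) → (∀ k : ℕ, 1 ≤ k → ∀ᵐ ω ∂μ, ∀ x : Literature.Probability.LatticeModels.Site 3, (Literature.Probability.Percolation.openCluster (ω \ {e | ∃ y : Literature.Probability.LatticeModels.Site 3, (∀ i, (2 ^ k : ℤ) ∣ y i) ∧ e = s(y, y + Pi.single (2 : Fin 3) 1)}) x).Finite) → μ (Literature.Probability.Percolation.percolatesAt (0 : Literature.Probability.LatticeModels.Site 3)) = 0 := by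
  sorry

/-- The line closes X₁ from its registered stubs (skeleton theorem: stubs used BY NAME). -/
theorem NoInfinitelyFragileGiant_holds_of_stubs :
    Summit.CriticalPhenomena.PercolationContinuityZ3.Theses.PercDustRigidity.NoInfinitelyFragileGiant := by
  intro μ hμ h1 h2 h3 h4 h5 h6 h7 h8 h9 hU hD
  exact stub_core μ hμ h1 h2 h3 h4 h5 h6 h7 h8 h9 hU (stub_robustUniqueness μ hμ h1 h2 h3 h4 h5 hU)
    (fun k hk m => stub_pieceMassTransport μ hμ h1 h2 k hk (hD k hk) m) hD

/-- Composition: the three stubs prove X₁. -/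
theorem NoInfinitelyFragileGiant_of
    (hRU : ∀ μ : MeasureTheory.Measure (Literature.Probability.Percolation.BondConfig (Literature.Probability.LatticeModels.Site 3)), MeasureTheory.IsProbabilityMeasure μ → (∀ᵐ ω ∂μ, ω ⊆ (Literature.Probability.LatticeModels.zdGraph 3).edgeSet) → (∀ (v : Literature.Probability.LatticeModels.Site 3) (S : Set (Literature.Probability.Percolation.BondConfig (Literature.Probability.LatticeModels.Site 3))), MeasurableSet S → μ (Literature.Probability.Percolation.BondConfig.relabel (Literature.Probability.Percolation.sym2Equiv (Literature.Probability.LatticeModels.Site.shift v)) ⁻¹' S) = μ S) → (∀ S : Set (Literature.Probability.Percolation.BondConfig (Literature.Probability.LatticeModels.Site 3)), MeasurableSet S → (∀ v : Literature.Probability.LatticeModels.Site 3, Literature.Probability.Percolation.BondConfig.relabel (Literature.Probability.Percolation.sym2Equiv (Literature.Probability.LatticeModels.Site.shift v)) ⁻¹' S = S) → μ S = 0 ∨ μ S = 1) → (∀ N : ℕ, ∃ c : ℝ, 0 < c ∧ ∀ S : Set (Literature.Probability.Percolation.BondConfig (Literature.Probability.LatticeModels.Site 3)), MeasurableSet S →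 c * μ.real ((fun ω : Literature.Probability.Percolation.BondConfig (Literature.Probability.LatticeModels.Site 3) => ω ∪ ↑(Literature.Probability.LatticeModels.edgesIn (Literature.Probability.LatticeModels.zdGraph 3) (Literature.Probability.LatticeModels.box 3 N))) ⁻¹' S) ≤ μ.real S) → (∀ N : ℕ, ∃ c : ℝ, 0 < c ∧ ∀ S : Set (Literature.Probability.Percolation.BondConfig (Literature.Probability.LatticeModels.Site 3)), MeasurableSet S → c * μ.real ((fun ω : Literature.Probability.Percolation.BondConfig (Literature.Probability.LatticeModels.Site 3) => ω \ ↑(Literature.Probability.LatticeModels.edgesIn (Literature.Probability.LatticeModels.zdGraph 3) (Literature.Probability.LatticeModels.box 3 N))) ⁻¹' S) ≤ μ.real S) → (∀ᵐ ω ∂μ, Literature.Probability.Percolation.numInfiniteClusters ω ≤ 1) → ∀ᵐ ω ∂μ, ∀ N : ℕ, Literature.Probability.Percolation.numInfiniteClusters (ω \ ↑(Literature.Probability.LatticeModels.edgesIn (Literature.Probability.LatticeModels.zdGraph 3) (Literature.Probability.LatticeModels.box 3 N))) ≤ 1)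
    (hMT : ∀ μ : MeasureTheory.Measure (Literature.Probability.Percolation.BondConfig (Literature.Probability.LatticeModels.Site 3)), MeasureTheory.IsProbabilityMeasure μ → (∀ᵐ ω ∂μ, ω ⊆ (Literature.Probability.LatticeModels.zdGraph 3).edgeSet) → (∀ (v : Literature.Probability.LatticeModels.Site 3) (S : Set (Literature.Probability.Percolation.BondConfig (Literature.Probability.LatticeModels.Site 3))), MeasurableSet S → μ (Literature.Probability.Percolation.BondConfig.relabel (Literature.Probability.Percolation.sym2Equiv (Literature.Probability.LatticeModels.Site.shift v)) ⁻¹' S) = μ S) → ∀ k : ℕ, 1 ≤ k → (∀ᵐ ω ∂μ, ∀ x : Literature.Probability.LatticeModels.Site 3, (Literature.Probability.Percolation.openCluster (ω \ {e | ∃ y : Literature.Probability.LatticeModels.Site 3, (∀ i, (2 ^ k : ℤ) ∣ y i) ∧ e = s(y, y + Pi.single (2 : Fin 3) 1)}) x).Finite) → ∀ m : ℕ, ∑ x ∈ Fintype.piFinset (fun _ : Fin 3 => Finset.Ico (0 : ℤ) (2 ^ k)), μ.real {ω | (Literature.Probability.Percolation.openCluster ω x).Infinite ∧ (Literature.Probability.Percolation.openCluster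 (ω \ {e | ∃ y : Literature.Probability.LatticeModels.Site 3, (∀ i, (2 ^ k : ℤ) ∣ y i) ∧ e = s(y, y + Pi.single (2 : Fin 3) 1)}) x).ncard ≤ m} ≤ 2 * m)
    (hcore : ∀ μ : MeasureTheory.Measure (Literature.Probability.Percolation.BondConfig (Literature.Probability.LatticeModels.Site 3)), MeasureTheory.IsProbabilityMeasure μ → (∀ᵐ ω ∂μ, ω ⊆ (Literature.Probability.LatticeModels.zdGraph 3).edgeSet) → (∀ (v : Literature.Probability.LatticeModels.Site 3) (S : Set (Literature.Probability.Percolation.BondConfig (Literature.Probability.LatticeModels.Site 3))), MeasurableSet S → μ (Literature.Probability.Percolation.BondConfig.relabel (Literature.Probability.Percolation.sym2Equiv (Literature.Probability.LatticeModels.Site.shift v)) ⁻¹' S) = μ S) → (∀ S : Set (Literature.Probability.Percolation.BondConfig (Literature.Probability.LatticeModels.Site 3)), MeasurableSet S → (∀ v : Literature.Probability.LatticeModels.Site 3, Literature.Probability.Percolation.BondConfig.relabel (Literature.Probability.Percolation.sym2Equiv (Literature.Probability.LatticeModels.Site.shift v)) ⁻¹' S = S) → μ S = 0 ∨ μ S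 = 1) → (∀ N : ℕ, ∃ c : ℝ, 0 < c ∧ ∀ S : Set (Literature.Probability.Percolation.BondConfig (Literature.Probability.LatticeModels.Site 3)), MeasurableSet S → c * μ.real ((fun ω : Literature.Probability.Percolation.BondConfig (Literature.Probability.LatticeModels.Site 3) => ω ∪ ↑(Literature.Probability.LatticeModels.edgesIn (Literature.Probability.LatticeModels.zdGraph 3) (Literature.Probability.LatticeModels.box 3 N))) ⁻¹' S) ≤ μ.real S) → (∀ N : ℕ, ∃ c : ℝ, 0 < c ∧ ∀ S : Set (Literature.Probability.Percolation.BondConfig (Literature.Probability.LatticeModels.Site 3)), MeasurableSet S → c * μ.real ((fun ω : Literature.Probability.Percolation.BondConfig (Literature.Probability.LatticeModels.Site 3) => ω \ ↑(Literature.Probability.LatticeModels.edgesIn (Literature.Probability.LatticeModels.zdGraph 3) (Literature.Probability.LatticeModels.box 3 N))) ⁻¹' S) ≤ μ.real S) → (∀ v : Literature.Probability.LatticeModels.Site 3, v ≠ 0 → Ergodic (Literature.Probability.Percolation.BondConfig.relabel (Literature.Probability.Percolation.sym2Equiv (Literature.Probability.LatticeModels.Site.shift v))) μ) → (∀ (γ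 : Literature.Probability.LatticeModels.zdGraph 3 ≃g Literature.Probability.LatticeModels.zdGraph 3) (A : Set (Literature.Probability.Percolation.BondConfig (Literature.Probability.LatticeModels.Site 3))), MeasurableSet A → μ (Literature.Probability.Percolation.BondConfig.relabel (Literature.Probability.Percolation.sym2Equiv γ.toEquiv) ⁻¹' A) = μ A) → (∀ A B : Set (Literature.Probability.Percolation.BondConfig (Literature.Probability.LatticeModels.Site 3)), IsUpperSet A → IsUpperSet B → MeasurableSet A → MeasurableSet B → μ A * μ B ≤ μ (A ∩ B)) → (∀ᵐ ω ∂μ, ∀ (i : Fin 3) (a : ℤ) (v : Literature.Probability.LatticeModels.Site 3), {y : Literature.Probability.LatticeModels.Site 3 | ω ∈ Literature.Probability.Percolation.openConnIn {x : Literature.Probability.LatticeModels.Site 3 | a ≤ x i} v y}.Finite ∧ {y : Literature.Probability.LatticeModels.Site 3 | ω ∈ Literature.Probability.Percolation.openConnIn {x : Literature.Probability.LatticeModels.Site 3 | x i ≤ a} v y}.Finite) → (∀ᵐ ω ∂μ, Literature.Probability.Percolation.numInfiniteClusters ω ≤ 1) → (∀ᵐ ω ∂μ, ∀ N : ℕ,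 Literature.Probability.Percolation.numInfiniteClusters (ω \ ↑(Literature.Probability.LatticeModels.edgesIn (Literature.Probability.LatticeModels.zdGraph 3) (Literature.Probability.LatticeModels.box 3 N))) ≤ 1) → (∀ k : ℕ, 1 ≤ k → ∀ m : ℕ, ∑ x ∈ Fintype.piFinset (fun _ : Fin 3 => Finset.Ico (0 : ℤ) (2 ^ k)), μ.real {ω | (Literature.Probability.Percolation.openCluster ω x).Infinite ∧ (Literature.Probability.Percolation.openCluster (ω \ {e | ∃ y : Literature.Probability.LatticeModels.Site 3, (∀ i, (2 ^ k : ℤ) ∣ y i) ∧ e = s(y, y + Pi.single (2 : Fin 3) 1)}) x).ncard ≤ m} ≤ 2 * m) → (∀ k : ℕ, 1 ≤ k → ∀ᵐ ω ∂μ, ∀ x : Literature.Probability.LatticeModels.Site 3, (Literature.Probability.Percolation.openCluster (ω \ {e | ∃ y : Literature.Probability.LatticeModels.Site 3, (∀ i, (2 ^ k : ℤ) ∣ y i) ∧ e = s(y, y + Pi.single (2 : Fin 3) 1)}) x).Finite) → μ (Literature.Probability.Percolation.percolatesAt (0 : Literature.Probability.LatticeModels.Site 3)) = 0) :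
    Summit.CriticalPhenomena.PercolationContinuityZ3.Theses.PercDustRigidity.NoInfinitelyFragileGiant := by
  intro μ hμ h1 h2 h3 h4 h5 h6 h7 h8 h9 hU hD
  exact hcore μ hμ h1 h2 h3 h4 h5 h6 h7 h8 h9 hU (hRU μ hμ h1 h2 h3 h4 h5 hU)
    (fun k hk m => hMT μ hμ h1 h2 k hk (hD k hk) m) hD

end Summit.CriticalPhenomena.PercolationContinuityZ3.Cruxes.NoInfinitelyFragileGiant.Birth
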